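import Mathlib
import Summits.KontsevichZagierPeriods.Zeta5Search.BrickKernelFrobenius

/-!
# BrickKernelFrobeniusTwo — the Frobenius factorisations of the CENTRE-FREE brick kernel at the prime `2` on the ODD
rows: `2^{A−B}·R_{2N+1}(2t−1) = Ψ_N(t)·(t−N−1)^B·R_N(t)` (odd poles) and `2^{A−B}·R_{2N+1}(2t) = Ψ′_N(t)·(t+2N+1)^B·R_N(t)`
(even poles), with `Ψ, Ψ′` ratios of products of ODD linear forms (cell `pub-zeta5`, seat ct-1 g42)

HONEST FRAMING: systematic search; no irrationality claim unless certified.  INSTRUMENT identities of rational functions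
(any field, `2 ≠ 0`) about `R_n(t) = brickKernel A B 0 n t = n!^{A−2B}∏_{m=1}^{n}(t−m)^B∏_{m=1}^{n}(t+n+m)^B/∏_{m=0}^{n}(t+m)^A`
(`BrickKernelFrobenius.brickKernel`, `ε = 0`); nothing about `ζ(5)`/`ζ(3)`; no `γ`/record statement; records in print
UNMOVED; NOTHING IS DISCHARGED (net named-fact debt 0).

WHY: the tree's Frobenius factorisation `p^A·R_{np}(pt) = p^ε·Φ_{n,p}(t)·R_n(t)` (`brickKernel_frobenius`, every `p`) relates
the poles `Kp` of the row `np` to the poles `K` of the row `n`; the other digits are handled in the zeta5-irr chain by the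
«digit strip» (`BrickDigitStrip*`, odd `p`).  At `p = 2` the rows are `2N` (poles `2K` by `Φ_{N,2}`; odd poles are holes,
`BrickHoleCellsAllPrimes`) and `2N+1`, and on the ODD rows the strip degenerates into two explicit factorisations:

* **`brickKernel_two_odd_row_odd`** — `2^{A−B}·R_{2N+1}(2t−1) = Ψ_N(t)·(t−N−1)^B·R_N(t)`,
  `Ψ_N(t) = D^{A−2B}·[∏_{i=1}^{N}(2t−2i−1)·∏_{i=0}^{N}(2t+2N+2i+1)]^B/[∏_{i=0}^{N}(2t+2i−1)]^A`, `D = ∏_{i=0}^{N}(2i+1) = (2N+1)!!`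
  — the ODD poles `2K+1` of `R_{2N+1}` sit at `t = −K`, over the poles of `R_N`;
* **`brickKernel_two_odd_row_even`** — `2^{A−B}·R_{2N+1}(2t) = Ψ′_N(t)·(t+2N+1)^B·R_N(t)`,
  `Ψ′_N(t) = D^{A−2B}·[∏_{i=0}^{N}(2t−2i−1)·∏_{i=1}^{N}(2t+2N+2i+1)]^B/[∏_{i=0}^{N}(2t+2i+1)]^A` — the EVEN poles `2K`;
* the splittings `prod_range_even_odd`, `prod_Icc_even_odd` (`∏_{m≤2N+1}f(m)` into even and odd `m`) and
  `factorial_two_mul_succ` (`(2N+1)! = 2^N·N!·D`).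

Every linear form in `Ψ, Ψ′` is `2t ± (odd)`: at an integer `t` it is odd, so (as for `Φ_{n,2}` in `BrickPhiAllPrimes`) the
Taylor coefficients of `Ψ(−K+T)` lie in `2^mℤ_(2)` with a unit constant term; the polynomial factors `(t−N−1)^B`,
`(t+2N+1)^B` carry the non-unit part `(N+K+1)^B`, `(2N+1−K)^B` of the top-coefficient ratio.  With the exponent `A − B`
(not `A`) these are the `p = 2` replacements of «(B1)» on odd rows.  Theorems only (0 `def`); nothing restated.
-/

namespace Summit.KontsevichZagierPeriods.Zeta5Search.BrickKernelFrobeniusTwo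

open Finset Nat
open Summit.KontsevichZagierPeriods.Zeta5Search.BrickKernelFrobenius (brickKernel)

/-! ## Splitting products over `[0, 2N+1]` and `[1, 2N+1]` into even and odd indices -/

/-- `∏_{m < 2N+2} f(m) = ∏_{i ≤ N} f(2i) · ∏_{i ≤ N} f(2i+1)`. [folklore] -/
theorem prod_range_even_odd {M : Type*} [CommMonoid M] (f : ℕ → M) (N : ℕ) :
    ∏ m ∈ range (2 * N + 1 + 1), f m = (∏ i ∈ range (N + 1), f (2 * i)) * ∏ i ∈ range (N + 1), f (2 * i + 1) := by
  induction N with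
  | zero => simp [Finset.prod_range_succ]
  | succ N ih =>
    have h1 : 2 * (N + 1) + 1 + 1 = (2 * N + 1 + 1) + 1 + 1 := by ring
    rw [h1, Finset.prod_range_succ, Finset.prod_range_succ, ih, Finset.prod_range_succ _ (N + 1),
      Finset.prod_range_succ _ (N + 1)]
    have h3 : 2 * N + 1 + 1 + 1 = 2 * (N + 1) + 1 := by ring
    have h2 : 2 * N + 1 + 1 = 2 * (N + 1) := by ring
    rw [h3, h2]
    simp only [mul_assoc, mul_comm, mul_left_comm]

/-- `∏_{1 ≤ m ≤ 2N+1} f(m) = ∏_{1 ≤ i ≤ N} f(2i) · ∏_{i ≤ N} f(2i+1)`. [folklore] -/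
theorem prod_Icc_even_odd {M : Type*} [CommMonoid M] (f : ℕ → M) (N : ℕ) :
    ∏ m ∈ Icc 1 (2 * N + 1), f m = (∏ i ∈ Icc 1 N, f (2 * i)) * ∏ i ∈ range (N + 1), f (2 * i + 1) := by
  induction N with
  | zero => simp
  | succ N ih =>
    have h1 : 2 * (N + 1) + 1 = (2 * N + 1) + 1 + 1 := by ring
    rw [h1, Finset.prod_Icc_succ_top (by omega), Finset.prod_Icc_succ_top (by omega), ih,
      Finset.prod_Icc_succ_top (by omega), Finset.prod_range_succ _ (N + 1)]
    have h2 : 2 * N + 1 + 1 = 2 * (N + 1) := by ring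
    rw [h2]
    simp only [mul_assoc, mul_comm, mul_left_comm]

/-- `(2N+1)! = 2^N · N! · ∏_{i ≤ N}(2i+1)`. [folklore] -/
theorem factorial_two_mul_succ (N : ℕ) : (2 * N + 1)! = 2 ^ N * N ! * ∏ i ∈ range (N + 1), (2 * i + 1) := by
  induction N with
  | zero => simp
  | succ N ih =>
    have h1 : 2 * (N + 1) + 1 = (2 * N + 1) + 1 + 1 := by ring
    rw [h1, Nat.factorial_succ, Nat.factorial_succ, ih, Finset.prod_range_succ _ (N + 1), Nat.factorial_succ, pow_succ]
    ring

section kernel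

variable {K : Type*} [Field K]

/-- The algebra of the odd-pole factorisation: for `x ≠ 0` (here `x = 2`),
`x^{C+B}·[(x^N e w)^C (q₁ (x^{N+1} a a₁))^B ((x^N a') q₂)^B / (q₃ (x^{N+1} b))^{C+2B}]
 = (w^C (q₁ q₂)^B / q₃^{C+2B}) · a₁^B · (e^C a^B a'^B / b^{C+2B})`. [folklore] -/
private theorem algebra {x : K} (hx : x ≠ 0) (N B C : ℕ) (a a₁ a' b e w q₁ q₂ q₃ : K) :
    x ^ (C + B) * ((x ^ N * e * w) ^ C * (q₁ * (x ^ (N + 1) * a * a₁)) ^ B * ((x ^ N * a') * q₂) ^ B /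
        (q₃ * (x ^ (N + 1) * b)) ^ (C + 2 * B)) =
      (w ^ C * (q₁ * q₂) ^ B / q₃ ^ (C + 2 * B)) * a₁ ^ B * (e ^ C * a ^ B * a' ^ B / b ^ (C + 2 * B)) := by
  rcases Nat.eq_zero_or_pos (C + 2 * B) with h0 | h0
  · have hC : C = 0 := by omega
    have hB : B = 0 := by omega
    subst hC; subst hB
    simp
  by_cases hb : b = 0
  · subst hb; simp [zero_pow h0.ne']
  by_cases hq : q₃ = 0
  · subst hq; simp [zero_pow h0.ne']
  field_simp
  ring

/-- The algebra of the even-pole factorisation: for `x ≠ 0`,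
`x^{C+B}·[(x^N e w)^C (q₁ (x^N a))^B ((x^{N+1} a' a₁) q₂)^B / (q₃ (x^{N+1} b))^{C+2B}]
 = (w^C (q₁ q₂)^B / q₃^{C+2B}) · a₁^B · (e^C a^B a'^B / b^{C+2B})`. [folklore] -/
private theorem algebra' {x : K} (hx : x ≠ 0) (N B C : ℕ) (a a₁ a' b e w q₁ q₂ q₃ : K) :
    x ^ (C + B) * ((x ^ N * e * w) ^ C * (q₁ * (x ^ N * a)) ^ B * ((x ^ (N + 1) * a' * a₁) * q₂) ^ B /
        (q₃ * (x ^ (N + 1) * b)) ^ (C + 2 * B)) =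
      (w ^ C * (q₁ * q₂) ^ B / q₃ ^ (C + 2 * B)) * a₁ ^ B * (e ^ C * a ^ B * a' ^ B / b ^ (C + 2 * B)) := by
  rcases Nat.eq_zero_or_pos (C + 2 * B) with h0 | h0
  · have hC : C = 0 := by omega
    have hB : B = 0 := by omega
    subst hC; subst hB
    simp
  by_cases hb : b = 0
  · subst hb; simp [zero_pow h0.ne']
  by_cases hq : q₃ = 0
  · subst hq; simp [zero_pow h0.ne']
  field_simp
  ring

/-- **Odd row, odd poles**: for `2B ≤ A`, `(2 : K) ≠ 0`, every `N` and every `t` (poles included, by `x/0 = 0`):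
`2^{A−B}·R_{2N+1}(2t−1) = Ψ_N(t)·(t−N−1)^B·R_N(t)` with
`Ψ_N(t) = (∏_{i≤N}(2i+1))^{A−2B}·[∏_{1≤i≤N}(2t−2i−1)·∏_{i≤N}(2t+2N+2i+1)]^B/[∏_{i≤N}(2t+2i−1)]^A`.
The pole `2K+1` of `R_{2N+1}` is at `t = −K`, the pole `K` of `R_N`. -/
theorem brickKernel_two_odd_row_odd {A B : ℕ} (hAB : 2 * B ≤ A) (h2 : (2 : K) ≠ 0) (N : ℕ) (t : K) :
    (2 : K) ^ (A - B) * brickKernel A B 0 (2 * N + 1) (2 * t - 1) =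
      ((∏ i ∈ range (N + 1), (2 * (i : K) + 1)) ^ (A - 2 * B) *
          ((∏ i ∈ Icc 1 N, (2 * t - 2 * i - 1)) * ∏ i ∈ range (N + 1), (2 * t + 2 * N + 2 * i + 1)) ^ B /
          (∏ i ∈ range (N + 1), (2 * t + 2 * i - 1)) ^ A) *
        (t - N - 1) ^ B * brickKernel A B 0 N t := by
  obtain ⟨C, rfl⟩ : ∃ C, A = C + 2 * B := ⟨A - 2 * B, by omega⟩
  have e1 : ∏ m ∈ range (2 * N + 1 + 1), (2 * t - 1 + (m : K)) =
      (∏ i ∈ range (N + 1), (2 * t + 2 * i - 1)) * ((2 : K) ^ (N + 1) * ∏ i ∈ range (N + 1), (t + (i : K))) := by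
    rw [prod_range_even_odd (fun m => 2 * t - 1 + (m : K)) N]
    congr 1
    · exact Finset.prod_congr rfl fun i _ => by push_cast; ring
    · have h : ∏ i ∈ range (N + 1), (2 * t - 1 + ((2 * i + 1 : ℕ) : K)) = ∏ i ∈ range (N + 1), (2 * (t + (i : K))) :=
        Finset.prod_congr rfl fun i _ => by push_cast; ring
      rw [h, Finset.prod_mul_distrib, Finset.prod_const, Finset.card_range]
  have e2 : ∏ m ∈ Icc 1 (2 * N + 1), (2 * t - 1 - (m : K)) =
      (∏ i ∈ Icc 1 N, (2 * t - 2 * i - 1)) *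
        ((2 : K) ^ (N + 1) * (∏ i ∈ Icc 1 N, (t - (i : K))) * (t - N - 1)) := by
    rw [prod_Icc_even_odd (fun m => 2 * t - 1 - (m : K)) N]
    congr 1
    · exact Finset.prod_congr rfl fun i _ => by push_cast; ring
    · have h : ∏ i ∈ range (N + 1), (2 * t - 1 - ((2 * i + 1 : ℕ) : K)) =
          ∏ i ∈ range (N + 1), (2 * (t - ((i + 1 : ℕ) : K))) :=
        Finset.prod_congr rfl fun i _ => by push_cast; ring
      have h' : ∏ i ∈ range N, (t - ((i + 1 : ℕ) : K)) = ∏ i ∈ Icc 1 N, (t - (i : K)) := by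
        rw [← Finset.Ico_add_one_right_eq_Icc, Finset.prod_Ico_eq_prod_range, Nat.add_sub_cancel]
        exact Finset.prod_congr rfl fun i _ => by push_cast; ring
      rw [h, Finset.prod_mul_distrib, Finset.prod_const, Finset.card_range,
        Finset.prod_range_succ (fun i => t - ((i + 1 : ℕ) : K)) N, h']
      push_cast; ring
  have e3 : ∏ m ∈ Icc 1 (2 * N + 1), (2 * t - 1 + ((2 * N + 1 : ℕ) : K) + (m : K)) =
      ((2 : K) ^ N * ∏ i ∈ Icc 1 N, (t + N + (i : K))) * ∏ i ∈ range (N + 1), (2 * t + 2 * N + 2 * i + 1) := by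
    rw [prod_Icc_even_odd (fun m => 2 * t - 1 + ((2 * N + 1 : ℕ) : K) + (m : K)) N]
    congr 1
    · have h : ∏ i ∈ Icc 1 N, (2 * t - 1 + ((2 * N + 1 : ℕ) : K) + ((2 * i : ℕ) : K)) =
          ∏ i ∈ Icc 1 N, (2 * (t + N + (i : K))) :=
        Finset.prod_congr rfl fun i _ => by push_cast; ring
      rw [h, Finset.prod_mul_distrib, Finset.prod_const, Nat.card_Icc, Nat.add_sub_cancel]
    · exact Finset.prod_congr rfl fun i _ => by push_cast; ring
  have e4 : (((2 * N + 1)! : ℕ) : K) = (2 : K) ^ N * (N ! : K) * ∏ i ∈ range (N + 1), (2 * (i : K) + 1) := by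
    rw [factorial_two_mul_succ]; push_cast; rfl
  unfold brickKernel
  rw [Nat.add_sub_cancel, show C + 2 * B - B = C + B by omega, pow_zero, pow_zero, mul_one, mul_one, e1, e2, e3, e4]
  have key := algebra h2 N B C (∏ i ∈ Icc 1 N, (t - (i : K))) (t - N - 1) (∏ i ∈ Icc 1 N, (t + N + (i : K)))
    (∏ i ∈ range (N + 1), (t + (i : K))) (N ! : K) (∏ i ∈ range (N + 1), (2 * (i : K) + 1))
    (∏ i ∈ Icc 1 N, (2 * t - 2 * i - 1)) (∏ i ∈ range (N + 1), (2 * t + 2 * N + 2 * i + 1))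
    (∏ i ∈ range (N + 1), (2 * t + 2 * i - 1))
  linear_combination key

/-- **Odd row, even poles**: for `2B ≤ A`, `(2 : K) ≠ 0`, every `N`, `t`:
`2^{A−B}·R_{2N+1}(2t) = Ψ′_N(t)·(t+2N+1)^B·R_N(t)` with
`Ψ′_N(t) = (∏_{i≤N}(2i+1))^{A−2B}·[∏_{i≤N}(2t−2i−1)·∏_{1≤i≤N}(2t+2N+2i+1)]^B/[∏_{i≤N}(2t+2i+1)]^A`.
The pole `2K` of `R_{2N+1}` is at `t = −K`, the pole `K` of `R_N`. -/
theorem brickKernel_two_odd_row_even {A B : ℕ} (hAB : 2 * B ≤ A) (h2 : (2 : K) ≠ 0) (N : ℕ) (t : K) :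
    (2 : K) ^ (A - B) * brickKernel A B 0 (2 * N + 1) (2 * t) =
      ((∏ i ∈ range (N + 1), (2 * (i : K) + 1)) ^ (A - 2 * B) *
          ((∏ i ∈ range (N + 1), (2 * t - 2 * i - 1)) * ∏ i ∈ Icc 1 N, (2 * t + 2 * N + 2 * i + 1)) ^ B /
          (∏ i ∈ range (N + 1), (2 * t + 2 * i + 1)) ^ A) *
        (t + 2 * N + 1) ^ B * brickKernel A B 0 N t := by
  obtain ⟨C, rfl⟩ : ∃ C, A = C + 2 * B := ⟨A - 2 * B, by omega⟩
  have e1 : ∏ m ∈ range (2 * N + 1 + 1), (2 * t + (m : K)) =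
      (∏ i ∈ range (N + 1), (2 * t + 2 * i + 1)) * ((2 : K) ^ (N + 1) * ∏ i ∈ range (N + 1), (t + (i : K))) := by
    rw [prod_range_even_odd (fun m => 2 * t + (m : K)) N, mul_comm]
    congr 1
    · exact Finset.prod_congr rfl fun i _ => by push_cast; ring
    · have h : ∏ i ∈ range (N + 1), (2 * t + ((2 * i : ℕ) : K)) = ∏ i ∈ range (N + 1), (2 * (t + (i : K))) :=
        Finset.prod_congr rfl fun i _ => by push_cast; ring
      rw [h, Finset.prod_mul_distrib, Finset.prod_const, Finset.card_range]
  have e2 : ∏ m ∈ Icc 1 (2 * N + 1), (2 * t - (m : K)) =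
      (∏ i ∈ range (N + 1), (2 * t - 2 * i - 1)) * ((2 : K) ^ N * ∏ i ∈ Icc 1 N, (t - (i : K))) := by
    rw [prod_Icc_even_odd (fun m => 2 * t - (m : K)) N, mul_comm]
    congr 1
    · exact Finset.prod_congr rfl fun i _ => by push_cast; ring
    · have h : ∏ i ∈ Icc 1 N, (2 * t - ((2 * i : ℕ) : K)) = ∏ i ∈ Icc 1 N, (2 * (t - (i : K))) :=
        Finset.prod_congr rfl fun i _ => by push_cast; ring
      rw [h, Finset.prod_mul_distrib, Finset.prod_const, Nat.card_Icc, Nat.add_sub_cancel]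
  have e3 : ∏ m ∈ Icc 1 (2 * N + 1), (2 * t + ((2 * N + 1 : ℕ) : K) + (m : K)) =
      ((2 : K) ^ (N + 1) * (∏ i ∈ Icc 1 N, (t + N + (i : K))) * (t + 2 * N + 1)) *
        ∏ i ∈ Icc 1 N, (2 * t + 2 * N + 2 * i + 1) := by
    rw [prod_Icc_even_odd (fun m => 2 * t + ((2 * N + 1 : ℕ) : K) + (m : K)) N, mul_comm]
    congr 1
    · have h : ∏ i ∈ range (N + 1), (2 * t + ((2 * N + 1 : ℕ) : K) + ((2 * i + 1 : ℕ) : K)) =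
          ∏ i ∈ range (N + 1), (2 * (t + N + ((i + 1 : ℕ) : K))) :=
        Finset.prod_congr rfl fun i _ => by push_cast; ring
      have h' : ∏ i ∈ range N, (t + N + ((i + 1 : ℕ) : K)) = ∏ i ∈ Icc 1 N, (t + N + (i : K)) := by
        rw [← Finset.Ico_add_one_right_eq_Icc, Finset.prod_Ico_eq_prod_range, Nat.add_sub_cancel]
        exact Finset.prod_congr rfl fun i _ => by push_cast; ring
      rw [h, Finset.prod_mul_distrib, Finset.prod_const, Finset.card_range,
        Finset.prod_range_succ (fun i => t + N + ((i + 1 : ℕ) : K)) N, h']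
      push_cast; ring
    · exact Finset.prod_congr rfl fun i _ => by push_cast; ring
  have e4 : (((2 * N + 1)! : ℕ) : K) = (2 : K) ^ N * (N ! : K) * ∏ i ∈ range (N + 1), (2 * (i : K) + 1) := by
    rw [factorial_two_mul_succ]; push_cast; rfl
  unfold brickKernel
  rw [Nat.add_sub_cancel, show C + 2 * B - B = C + B by omega, pow_zero, pow_zero, mul_one, mul_one, e1, e2, e3, e4]
  have key := algebra' h2 N B C (∏ i ∈ Icc 1 N, (t - (i : K))) (t + 2 * N + 1) (∏ i ∈ Icc 1 N, (t + N + (i : K)))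
    (∏ i ∈ range (N + 1), (t + (i : K))) (N ! : K) (∏ i ∈ range (N + 1), (2 * (i : K) + 1))
    (∏ i ∈ range (N + 1), (2 * t - 2 * i - 1)) (∏ i ∈ Icc 1 N, (2 * t + 2 * N + 2 * i + 1))
    (∏ i ∈ range (N + 1), (2 * t + 2 * i + 1))
  linear_combination key

end kernel

end Summit.KontsevichZagierPeriods.Zeta5Search.BrickKernelFrobeniusTwo
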